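import Mathlib
import Summits.Ventures.PercRepro2.HalfLA1BMassesA

/-!
# The masses of the `L`-half for `a₃ ~ {a₁, b}`, part B (blind cell PercRepro2, night-1 g37)

`mass_oH`, `mass_bLoH`, `mass_ToU`, `mass_PD`, `mass_PDoU` in the vocabulary of `HalfLA1BMassesA`.
-/

namespace Summit.Ventures.PercRepro2

namespace HalfLA1B

open CaseOne HalfLTwoMark HalfLA2B

section MassesB

variable {V : Type*} {E : Type*} [Fintype E] [DecidableEq E] {R : Type*} [CommRing R]
variable {ends : E → Sym2 V} {o a₃ b : V} {e₁ e₂ : E}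

/-- **`P(Q, o ∈ H)`** for `a₃ ~ {a₁, b}`: `P(Q₀, oH) − r₁ r₂ HH`. -/
theorem mass_oH (p : E → R) {a₁ a₂ : V} (h : IsTwoMarkAt ends a₁ b a₃ e₁ e₂) (h2 : a₂ ≠ a₃)
    (ho3 : o ≠ a₃) :
    prob p ((connEvent ends a₁ a₂)ᶜ ∩ connEvent ends a₂ o) =
      moH (p e₁) (p e₂) (cellsA1B p ends o a₁ a₂ b e₁ e₂) := by
  set p00 := Function.update (Function.update p e₁ 0) e₂ 0 with hp00
  have h1 : a₁ ≠ a₃ := h.ne_o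
  have key := prob_twoPin p h.ne ((connEvent ends a₁ a₂)ᶜ ∩ connEvent ends a₂ o)
    ((connEvent ends a₁ a₂)ᶜ ∩ connEvent ends a₂ o ∩ (connEvent ends a₂ b)ᶜ)
    ((connEvent ends a₁ a₂)ᶜ ∩ connEvent ends a₂ o) ((connEvent ends a₁ a₂)ᶜ ∩ connEvent ends a₂ o)
    ((connEvent ends a₁ a₂)ᶜ ∩ connEvent ends a₂ o) ?_ ?_ ?_ ?_
  · rw [key]
    unfold moH cellsA1B cells10Of
    dsimp only
    rw [← hp00]
    have c := prob_inter_add_prob_inter_compl p00 ((connEvent ends a₁ a₂)ᶜ ∩ connEvent ends a₂ o)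
      (connEvent ends a₂ b)
    have sb := split_b p00 ends b a₁ a₂ (connEvent ends a₂ o)
    linear_combination (p e₁ * p e₂) * c + sb
  · intro ω ho hb
    rw [openCC_tt ho hb]
    simp only [Set.mem_compl_iff, Set.mem_inter_iff, mem_connEvent]
    rw [conn_both_iff h ω h1 h2, conn_both_iff h ω h2 ho3, base2_eq_self ho hb, conn_comm_iff ω b a₂,
      conn_comm_iff ω b o, conn_comm_iff ω a₂ a₁]
    have haa := conn_refl ends ω a₁
    tauto
  · intro ω ho hb
    rw [openCC_tf h.ne ho hb]
    simp only [Set.mem_compl_iff, Set.mem_inter_iff, mem_connEvent]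
    rw [conn_open_o_iff h ω h1 h2, conn_open_o_iff h ω h2 ho3, base2_eq_self ho hb]
  · intro ω ho hb
    rw [openCC_ft ho hb]
    simp only [Set.mem_compl_iff, Set.mem_inter_iff, mem_connEvent]
    rw [conn_open_b_iff h ω h1 h2, conn_open_b_iff h ω h2 ho3, base2_eq_self ho hb]
  · intro ω ho hb
    rw [openCC_ff ho hb, base2_eq_self ho hb]

/-- **`P(Q, o ∈ H, b ∈ L)`** for `a₃ ~ {a₁, b}`: `HL + r₁ r₂ HN`. -/
theorem mass_bLoH (p : E → R) {a₁ a₂ : V} (h : IsTwoMarkAt ends a₁ b a₃ e₁ e₂) (h2 : a₂ ≠ a₃)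
    (ho3 : o ≠ a₃) :
    prob p ((connEvent ends a₁ a₂)ᶜ ∩ connEvent ends a₂ o ∩ connEvent ends a₁ b) =
      mbLoH (p e₁) (p e₂) (cellsA1B p ends o a₁ a₂ b e₁ e₂) := by
  set p00 := Function.update (Function.update p e₁ 0) e₂ 0 with hp00
  have h1 : a₁ ≠ a₃ := h.ne_o
  have key := prob_twoPin p h.ne ((connEvent ends a₁ a₂)ᶜ ∩ connEvent ends a₂ o ∩ connEvent ends a₁ b)
    ((connEvent ends a₁ a₂)ᶜ ∩ connEvent ends a₂ o ∩ (connEvent ends a₂ b)ᶜ)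
    ((connEvent ends a₁ a₂)ᶜ ∩ connEvent ends a₂ o ∩ connEvent ends a₁ b)
    ((connEvent ends a₁ a₂)ᶜ ∩ connEvent ends a₂ o ∩ connEvent ends a₁ b)
    ((connEvent ends a₁ a₂)ᶜ ∩ connEvent ends a₂ o ∩ connEvent ends a₁ b) ?_ ?_ ?_ ?_
  · rw [key]
    unfold mbLoH cellsA1B cells10Of
    dsimp only
    rw [← hp00]
    have c := prob_inter_add_prob_inter_compl p00 ((connEvent ends a₁ a₂)ᶜ ∩ connEvent ends a₂ o)
      (connEvent ends a₂ b)
    have sb := split_b p00 ends b a₁ a₂ (connEvent ends a₂ o)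
    linear_combination (p e₁ * p e₂) * (c + sb)
  · intro ω ho hb
    rw [openCC_tt ho hb]
    simp only [Set.mem_compl_iff, Set.mem_inter_iff, mem_connEvent]
    rw [conn_both_iff h ω h1 h2, conn_both_iff h ω h2 ho3, conn_both_iff h ω h1 h.ne_b,
      base2_eq_self ho hb, conn_comm_iff ω b a₂, conn_comm_iff ω b o, conn_comm_iff ω a₂ a₁]
    have haa := conn_refl ends ω a₁
    have hbb := conn_refl ends ω b
    tauto
  · intro ω ho hb
    rw [openCC_tf h.ne ho hb]
    simp only [Set.mem_compl_iff, Set.mem_inter_iff, mem_connEvent]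
    rw [conn_open_o_iff h ω h1 h2, conn_open_o_iff h ω h2 ho3, conn_open_o_iff h ω h1 h.ne_b,
      base2_eq_self ho hb]
  · intro ω ho hb
    rw [openCC_ft ho hb]
    simp only [Set.mem_compl_iff, Set.mem_inter_iff, mem_connEvent]
    rw [conn_open_b_iff h ω h1 h2, conn_open_b_iff h ω h2 ho3, conn_open_b_iff h ω h1 h.ne_b,
      base2_eq_self ho hb]
  · intro ω ho hb
    rw [openCC_ff ho hb, base2_eq_self ho hb]

/-- **`P(T, o ∈ U)`** for `a₃ ~ {a₁, b}`: `(1 − r₁) r₂ (LH + HH)`. -/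
theorem mass_ToU (p : E → R) {a₁ a₂ : V} (h : IsTwoMarkAt ends a₁ b a₃ e₁ e₂) (h2 : a₂ ≠ a₃)
    (ho3 : o ≠ a₃) :
    prob p ((connEvent ends a₁ a₂)ᶜ ∩ connEvent ends a₂ a₃ ∩ (connEvent ends a₁ o ∪ connEvent ends a₂ o)) =
      mToU (p e₁) (p e₂) (cellsA1B p ends o a₁ a₂ b e₁ e₂) := by
  set p00 := Function.update (Function.update p e₁ 0) e₂ 0 with hp00
  have h1 : a₁ ≠ a₃ := h.ne_o
  have key := prob_twoPin p h.ne
    ((connEvent ends a₁ a₂)ᶜ ∩ connEvent ends a₂ a₃ ∩ (connEvent ends a₁ o ∪ connEvent ends a₂ o))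
    ∅ ∅
    (((connEvent ends a₁ a₂)ᶜ ∩ connEvent ends a₁ o ∩ connEvent ends a₂ b) ∪
      ((connEvent ends a₁ a₂)ᶜ ∩ connEvent ends a₂ o ∩ connEvent ends a₂ b))
    ∅ ?_ ?_ ?_ ?_
  · rw [key]
    unfold mToU cellsA1B cells10Of
    dsimp only
    rw [← hp00, prob_empty]
    have d : Disjoint ((connEvent ends a₁ a₂)ᶜ ∩ connEvent ends a₁ o ∩ connEvent ends a₂ b)
        ((connEvent ends a₁ a₂)ᶜ ∩ connEvent ends a₂ o ∩ connEvent ends a₂ b) :=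
      Set.disjoint_left.2 fun ω h1 h2 => not_both h1.1.1 h1.1.2 h2.1.2
    rw [prob_union_of_disjoint p00 d]
    ring
  · intro ω ho hb
    rw [openCC_tt ho hb]
    simp only [Set.mem_compl_iff, Set.mem_inter_iff, Set.mem_union, mem_connEvent,
      Set.mem_empty_iff_false, iff_false]
    rw [conn_both_iff h ω h1 h2, conn_both_a3_iff h ω h2, base2_eq_self ho hb, conn_comm_iff ω b a₂,
      conn_comm_iff ω a₂ a₁]
    have haa := conn_refl ends ω a₁
    intro hc
    have hc1 := hc.1
    clear hc
    tauto
  · intro ω ho hb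
    rw [openCC_tf h.ne ho hb]
    simp only [Set.mem_compl_iff, Set.mem_inter_iff, Set.mem_union, mem_connEvent,
      Set.mem_empty_iff_false, iff_false]
    rw [conn_open_o_iff h ω h1 h2, conn_open_o_a3_iff h ω h2, base2_eq_self ho hb]
    exact fun hc => hc.1.1 (conn_symm hc.1.2)
  · intro ω ho hb
    rw [openCC_ft ho hb]
    simp only [Set.mem_compl_iff, Set.mem_inter_iff, Set.mem_union, mem_connEvent]
    rw [conn_open_b_iff h ω h1 h2, conn_open_b_a3_iff h ω h2, conn_open_b_iff h ω h1 ho3,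
      conn_open_b_iff h ω h2 ho3, base2_eq_self ho hb]
    tauto
  · intro ω ho hb
    rw [openCC_ff ho hb]
    simp only [Set.mem_compl_iff, Set.mem_inter_iff, Set.mem_union, mem_connEvent,
      Set.mem_empty_iff_false, iff_false]
    exact fun hc => not_conn_base2 h ω h2 hc.1.2

/-- **`P(PD)`** for `a₃ ~ {a₁, b}`: `(1 − r₁)[(1 − r₂) M + r₂ P(Q₀, b ∉ U)]`. -/
theorem mass_PD (p : E → R) {a₁ a₂ : V} (h : IsTwoMarkAt ends a₁ b a₃ e₁ e₂) (h2 : a₂ ≠ a₃) :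
    prob p ((connEvent ends a₁ a₂)ᶜ ∩ (connEvent ends a₃ a₁ ∪ connEvent ends a₃ a₂)ᶜ) =
      mPD (p e₁) (p e₂) (cellsA1B p ends o a₁ a₂ b e₁ e₂) := by
  set p00 := Function.update (Function.update p e₁ 0) e₂ 0 with hp00
  have h1 : a₁ ≠ a₃ := h.ne_o
  have key := prob_twoPin p h.ne
    ((connEvent ends a₁ a₂)ᶜ ∩ (connEvent ends a₃ a₁ ∪ connEvent ends a₃ a₂)ᶜ)
    ∅ ∅ ((connEvent ends a₁ a₂)ᶜ ∩ (connEvent ends a₁ b ∪ connEvent ends a₂ b)ᶜ)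
    (connEvent ends a₁ a₂)ᶜ ?_ ?_ ?_ ?_
  · rw [key]
    unfold mPD cellsA1B cells10Of
    dsimp only
    rw [← hp00, prob_empty]
    have so := split_o p00 ends o a₁ a₂ (connEvent ends a₁ b ∪ connEvent ends a₂ b)ᶜ
    have tot := total_cells p00 ends o b a₁ a₂
    have nn := split_NN p00 ends o a₁ a₂ b
    linear_combination ((1 - p e₁) * p e₂) * (so + nn) + ((1 - p e₁) * (1 - p e₂)) * (tot + nn)
  · intro ω ho hb
    rw [openCC_tt ho hb]
    simp only [Set.mem_compl_iff, Set.mem_inter_iff, Set.mem_union, mem_connEvent,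
      Set.mem_empty_iff_false, iff_false]
    rw [conn_both_iff h ω h1 h2, conn_comm_iff _ a₃ a₁, conn_comm_iff _ a₃ a₂,
      conn_both_a3_iff h ω h1, conn_both_a3_iff h ω h2, base2_eq_self ho hb, conn_comm_iff ω a₂ a₁]
    have haa := conn_refl ends ω a₁
    tauto
  · intro ω ho hb
    rw [openCC_tf h.ne ho hb]
    simp only [Set.mem_compl_iff, Set.mem_inter_iff, Set.mem_union, mem_connEvent,
      Set.mem_empty_iff_false, iff_false]
    rw [conn_open_o_iff h ω h1 h2, conn_comm_iff _ a₃ a₁, conn_comm_iff _ a₃ a₂,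
      conn_open_o_a3_iff h ω h1, conn_open_o_a3_iff h ω h2, base2_eq_self ho hb]
    have haa := conn_refl ends ω a₁
    tauto
  · intro ω ho hb
    rw [openCC_ft ho hb]
    simp only [Set.mem_compl_iff, Set.mem_inter_iff, Set.mem_union, mem_connEvent]
    rw [conn_open_b_iff h ω h1 h2, conn_comm_iff _ a₃ a₁, conn_comm_iff _ a₃ a₂,
      conn_open_b_a3_iff h ω h1, conn_open_b_a3_iff h ω h2, base2_eq_self ho hb]
  · intro ω ho hb
    rw [openCC_ff ho hb, base2_eq_self ho hb]
    simp only [Set.mem_compl_iff, Set.mem_inter_iff, Set.mem_union, mem_connEvent]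
    constructor
    · exact fun hc => hc.1
    · intro hq
      refine ⟨hq, ?_⟩
      rintro (hc | hc)
      · exact h1 (isolated_of_closed h ho hb hc)
      · exact h2 (isolated_of_closed h ho hb hc)

/-- **`P(PD, o ∈ U)`** for `a₃ ~ {a₁, b}`. -/
theorem mass_PDoU (p : E → R) {a₁ a₂ : V} (h : IsTwoMarkAt ends a₁ b a₃ e₁ e₂) (h2 : a₂ ≠ a₃)
    (ho3 : o ≠ a₃) :
    prob p ((connEvent ends a₁ a₂)ᶜ ∩ (connEvent ends a₃ a₁ ∪ connEvent ends a₃ a₂)ᶜ ∩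
        (connEvent ends a₁ o ∪ connEvent ends a₂ o)) =
      mPDoU (p e₁) (p e₂) (cellsA1B p ends o a₁ a₂ b e₁ e₂) := by
  set p00 := Function.update (Function.update p e₁ 0) e₂ 0 with hp00
  have h1 : a₁ ≠ a₃ := h.ne_o
  have key := prob_twoPin p h.ne
    ((connEvent ends a₁ a₂)ᶜ ∩ (connEvent ends a₃ a₁ ∪ connEvent ends a₃ a₂)ᶜ ∩
        (connEvent ends a₁ o ∪ connEvent ends a₂ o))
    ∅ ∅
    (((connEvent ends a₁ a₂)ᶜ ∩ connEvent ends a₁ o ∩ (connEvent ends a₁ b ∪ connEvent ends a₂ b)ᶜ) ∪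
      ((connEvent ends a₁ a₂)ᶜ ∩ connEvent ends a₂ o ∩ (connEvent ends a₁ b ∪ connEvent ends a₂ b)ᶜ))
    (((connEvent ends a₁ a₂)ᶜ ∩ connEvent ends a₁ o) ∪ ((connEvent ends a₁ a₂)ᶜ ∩ connEvent ends a₂ o))
    ?_ ?_ ?_ ?_
  · rw [key]
    unfold mPDoU cellsA1B cells10Of
    dsimp only
    rw [← hp00, prob_empty]
    have d : Disjoint ((connEvent ends a₁ a₂)ᶜ ∩ connEvent ends a₁ o ∩
          (connEvent ends a₁ b ∪ connEvent ends a₂ b)ᶜ)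
        ((connEvent ends a₁ a₂)ᶜ ∩ connEvent ends a₂ o ∩ (connEvent ends a₁ b ∪ connEvent ends a₂ b)ᶜ) :=
      Set.disjoint_left.2 fun ω h1 h2 => not_both h1.1.1 h1.1.2 h2.1.2
    have d' : Disjoint ((connEvent ends a₁ a₂)ᶜ ∩ connEvent ends a₁ o)
        ((connEvent ends a₁ a₂)ᶜ ∩ connEvent ends a₂ o) :=
      Set.disjoint_left.2 fun ω h1 h2 => not_both h1.1 h1.2 h2.2
    rw [prob_union_of_disjoint p00 d, prob_union_of_disjoint p00 d']
    have s1 := split_b p00 ends b a₁ a₂ (connEvent ends a₁ o)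
    have s2 := split_b p00 ends b a₁ a₂ (connEvent ends a₂ o)
    linear_combination ((1 - p e₁) * (1 - p e₂)) * (s1 + s2)
  · intro ω ho hb
    rw [openCC_tt ho hb]
    simp only [Set.mem_compl_iff, Set.mem_inter_iff, Set.mem_union, mem_connEvent,
      Set.mem_empty_iff_false, iff_false]
    rw [conn_both_iff h ω h1 h2, conn_comm_iff _ a₃ a₁, conn_comm_iff _ a₃ a₂,
      conn_both_a3_iff h ω h1, conn_both_a3_iff h ω h2, base2_eq_self ho hb, conn_comm_iff ω a₂ a₁]
    have haa := conn_refl ends ω a₁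
    intro hc
    have hc1 := hc.1
    clear hc
    tauto
  · intro ω ho hb
    rw [openCC_tf h.ne ho hb]
    simp only [Set.mem_compl_iff, Set.mem_inter_iff, Set.mem_union, mem_connEvent,
      Set.mem_empty_iff_false, iff_false]
    rw [conn_open_o_iff h ω h1 h2, conn_comm_iff _ a₃ a₁, conn_comm_iff _ a₃ a₂,
      conn_open_o_a3_iff h ω h1, conn_open_o_a3_iff h ω h2, base2_eq_self ho hb]
    have haa := conn_refl ends ω a₁
    intro hc
    have hc1 := hc.1
    clear hc
    tauto
  · intro ω ho hb
    rw [openCC_ft ho hb]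
    simp only [Set.mem_compl_iff, Set.mem_inter_iff, Set.mem_union, mem_connEvent]
    rw [conn_open_b_iff h ω h1 h2, conn_comm_iff _ a₃ a₁, conn_comm_iff _ a₃ a₂,
      conn_open_b_a3_iff h ω h1, conn_open_b_a3_iff h ω h2, conn_open_b_iff h ω h1 ho3,
      conn_open_b_iff h ω h2 ho3, base2_eq_self ho hb]
    tauto
  · intro ω ho hb
    rw [openCC_ff ho hb, base2_eq_self ho hb]
    simp only [Set.mem_compl_iff, Set.mem_inter_iff, Set.mem_union, mem_connEvent]
    have n1 : ¬ Conn ends ω a₃ a₁ := fun hc => h1 (isolated_of_closed h ho hb hc)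
    have n2 : ¬ Conn ends ω a₃ a₂ := fun hc => h2 (isolated_of_closed h ho hb hc)
    tauto

end MassesB

end HalfLA1B

end Summit.Ventures.PercRepro2
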